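import Literature.AlgebraicGeometry.Resolution.CobordantBlowupFiltration
import Mathlib.RingTheory.Localization.LocalizationLocalization
import Mathlib.RingTheory.Localization.AtPrime.Basic
import HarnessLib

/-!
# Cobordant blow-ups (Włodarczyk 2022): extended Rees algebras localize at an ARBITRARY submonoid (in particular at a prime)

Topic: `Literature/AlgebraicGeometry/Resolution`. Sequel of `CobordantBlowupFiltration.lean`, which proves that the
extended Rees algebra `R[t⁻¹] = ⊕ₙ 𝒥ₙ tⁿ` of a filtration localizes at an ELEMENT (`isLocalization_away_extendedRees`, the
quasi-coherence of `Spec_Y ⊕ 𝒥ₙ tⁿ`, Włodarczyk App. Def. 5.1.1). Here the same statement for an arbitrary submonoid `M`: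
if `A'` is the localization of `A` at `M` and `𝒥ₙ' = 𝒥ₙ A'`, then `R'[t⁻¹]` is the localization of `R[t⁻¹]` at (the image
of) `M`. Consequence (the case `M = A ∖ 𝔭`): the local rings of the full cobordant blow-up `B = Spec_Y(R[t⁻¹])` at the points
over `y ∈ Y` are the localizations of the extended Rees algebra of the STALK filtration `𝒥ₙ,y ⊆ 𝒪_{Y,y}` — the dictionary
between the scheme-level cobordant blow-up and the local weighted game played in `𝒪_{Y,y}` (door crux
`HypersurfaceCentreConstruction` of route `WeightedInvariant`, assembly step [S6]).

* `IdealFiltration.exists_of_coeffMem_map_of_isLocalization` — clearing denominators coefficientwise;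
* `IdealFiltration.isLocalization_extendedRees` — `R'[t⁻¹]` is the localization of `R[t⁻¹]` at `M`;
* `IdealFiltration.isLocalization_atPrime_extendedRees_localization` — for a prime `𝔫'` of `R'[t⁻¹]` the local ring
  `R'[t⁻¹]_{𝔫'}` is the localization of `R[t⁻¹]` at the contracted prime (localization of a localization).
-/

noncomputable section

open scoped LaurentPolynomial
open LaurentPolynomial

namespace Literature.AlgebraicGeometry.Resolution

universe u v

namespace IdealFiltration

section Localization

variable {A : Type u} [CommRing A] {A' : Type v} [CommRing A'] [Algebra A A']
variable (F : IdealFiltration A) (F' : IdealFiltration A') (M : Submonoid A) [IsLocalization M A']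

/-- Over the localization `A' = M⁻¹A`: every `a' ∈ A'` satisfying the degree-`m` condition for the extended filtration
`𝒥ₙ' = 𝒥ₙ A'` is `a / s` with `s ∈ M` and `a` satisfying the degree-`m` condition for `𝒥`. [cite: Wlodarczyk2022, Def. 5.1.1] -/
theorem exists_of_coeffMem_map_of_isLocalization (heq : ∀ n, F'.ideal n = (F.ideal n).map (algebraMap A A'))
    {m : ℤ} {a' : A'} (ha' : F'.CoeffMem m a') :
    ∃ (s : M) (a : A), F.CoeffMem m a ∧ a' * algebraMap A A' s = algebraMap A A' a := by
  rcases lt_or_ge m 0 with hm | hm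
  · obtain ⟨⟨a, s⟩, h⟩ := IsLocalization.surj M a'
    exact ⟨s, a, coeffMem_of_neg hm a, h⟩
  · obtain ⟨n, rfl⟩ := Int.eq_ofNat_of_zero_le hm
    have hmem : a' ∈ (F.ideal n).map (algebraMap A A') := by
      rw [← heq n]
      exact coeffMem_natCast_iff.mp ha'
    obtain ⟨⟨⟨a, ha⟩, s⟩, h⟩ := (IsLocalization.mem_map_algebraMap_iff M A').mp hmem
    exact ⟨s, a, coeffMem_natCast_iff.mpr ha, h⟩

/-- **Extended Rees algebras localize** (general submonoid). If `A' = M⁻¹A` and `𝒥ₙ' = 𝒥ₙ A'` for all `n`, then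
`R'[t⁻¹] = ⊕ 𝒥ₙ' tⁿ` is the localization of `R[t⁻¹] = ⊕ 𝒥ₙ tⁿ` at the image of `M`. [cite: Wlodarczyk2022, Def. 5.1.1] -/
theorem isLocalization_extendedRees (heq : ∀ n, F'.ideal n = (F.ideal n).map (algebraMap A A')) :
    letI := (F.extendedReesMap F' fun n => (heq n).ge).toAlgebra
    IsLocalization (M.map (algebraMap A F.extendedRees)) F'.extendedRees := by
  letI := (F.extendedReesMap F' fun n => (heq n).ge).toAlgebra
  have hle : ∀ n, (F.ideal n).map (algebraMap A A') ≤ F'.ideal n := fun n => (heq n).ge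
  have halg : ∀ p : F.extendedRees, algebraMap F.extendedRees F'.extendedRees p =
      F.extendedReesMap F' hle p := fun _ => rfl
  set φ := algebraMap A A' with hφ
  have hmapC : ∀ x : A, AddMonoidAlgebra.mapRingHom ℤ φ (C x) = C (φ x) := fun x => by
    rw [← single_eq_C, AddMonoidAlgebra.mapRingHom_single, single_eq_C]
  -- the image of `C s`, `s ∈ M`, is `C (s/1)`
  have hCs : ∀ s : A, ((algebraMap F.extendedRees F'.extendedRees (algebraMap A F.extendedRees s) :
      F'.extendedRees) : A'[T;T⁻¹]) = C (φ s) := by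
    intro s
    rw [halg, coe_extendedReesMap, Subalgebra.coe_algebraMap, ← C_eq_algebraMap, hmapC]
  refine (isLocalization_iff _ _).mpr ⟨?_, ?_, fun {p q} hpq => ?_⟩
  · -- elements of `M` become units
    rintro ⟨_, s, hs, rfl⟩
    have hu : IsUnit (algebraMap A' F'.extendedRees (φ s)) :=
      (IsLocalization.map_units A' ⟨s, hs⟩).map _
    convert hu using 1
    apply Subtype.ext
    rw [hCs s, Subalgebra.coe_algebraMap, C_eq_algebraMap]
  · -- every element of `R'[t⁻¹]` is a fraction: decompose along the (finite) support and clear denominators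
    -- coefficientwise with a common denominator in `M`
    intro z
    have key : ∀ t : Finset ℤ, (∀ m ∈ t, F'.CoeffMem m ((z : A'[T;T⁻¹]).coeff m)) →
        ∃ (s : M) (a : A[T;T⁻¹]), a ∈ F.extendedRees ∧
          (∑ m ∈ t, AddMonoidAlgebra.single m ((z : A'[T;T⁻¹]).coeff m)) * C (φ s) =
            AddMonoidAlgebra.mapRingHom ℤ φ a := by
      classical
      intro t
      induction t using Finset.induction_on with
      | empty =>
        intro _
        exact ⟨1, 0, Subalgebra.zero_mem _, by simp⟩
      | insert m t hm ih =>
        intro ht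
        obtain ⟨s₁, a₁, ha₁, h₁⟩ := ih fun m' hm' => ht m' (Finset.mem_insert_of_mem hm')
        obtain ⟨s₂, a, ha, hka⟩ :=
          F.exists_of_coeffMem_map_of_isLocalization F' M heq (ht m (Finset.mem_insert_self m t))
        refine ⟨s₁ * s₂, AddMonoidAlgebra.single m a * C (s₁ : A) + a₁ * C (s₂ : A),
          Subalgebra.add_mem _ (F.mul_C_mem_extendedRees ((F.single_mem_extendedRees_iff).mpr ha) _)
            (F.mul_C_mem_extendedRees ha₁ _), ?_⟩
        have e1 : AddMonoidAlgebra.single m ((z : A'[T;T⁻¹]).coeff m) * C (φ ((s₁ * s₂ : M) : A)) =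
            AddMonoidAlgebra.mapRingHom ℤ φ (AddMonoidAlgebra.single m a * C (s₁ : A)) := by
          rw [map_mul, AddMonoidAlgebra.mapRingHom_single, hmapC, ← hka, ← single_eq_C,
            ← single_eq_C, AddMonoidAlgebra.single_mul_single, AddMonoidAlgebra.single_mul_single,
            Submonoid.coe_mul, map_mul]
          congr 1
          ring
        have e2 : (∑ m ∈ t, AddMonoidAlgebra.single m ((z : A'[T;T⁻¹]).coeff m)) * C (φ ((s₁ * s₂ : M) : A)) =
            AddMonoidAlgebra.mapRingHom ℤ φ (a₁ * C (s₂ : A)) := by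
          rw [Submonoid.coe_mul, map_mul, map_mul, ← mul_assoc, h₁, map_mul, hmapC]
        rw [Finset.sum_insert hm, add_mul, e1, e2, ← map_add]
    obtain ⟨s, a, ha, h⟩ := key (z : A'[T;T⁻¹]).coeff.support fun m _ => z.2 m
    refine ⟨⟨⟨a, ha⟩, ⟨algebraMap A F.extendedRees s, Submonoid.mem_map_of_mem _ s.2⟩⟩, Subtype.ext ?_⟩
    rw [MulMemClass.coe_mul, hCs, halg, coe_extendedReesMap, ← h]
    congr 1
    exact (AddMonoidAlgebra.sum_coeff_single (z : A'[T;T⁻¹])).symm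
  · -- the kernel is `M`-torsion
    have hcoeff : ∀ m, φ ((p : A[T;T⁻¹]).coeff m) = φ ((q : A[T;T⁻¹]).coeff m) := by
      intro m
      have := congrArg (fun r : F'.extendedRees => (r : A'[T;T⁻¹]).coeff m) hpq
      simpa only [halg, coe_extendedReesMap, AddMonoidAlgebra.coeff_mapRingHom] using this
    -- a common element of `M` killing all the (finitely many) differences of coefficients
    have key : ∀ t : Finset ℤ, ∃ s : M, ∀ m ∈ t,
        (s : A) * (p : A[T;T⁻¹]).coeff m = (s : A) * (q : A[T;T⁻¹]).coeff m := by
      classical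
      intro t
      induction t using Finset.induction_on with
      | empty => exact ⟨1, fun m hm => absurd hm (Finset.notMem_empty m)⟩
      | insert m t hm ih =>
        obtain ⟨s₁, hs₁⟩ := ih
        obtain ⟨s₂, hs₂⟩ := IsLocalization.exists_of_eq (M := M) (hcoeff m)
        refine ⟨s₁ * s₂, fun m' hm' => ?_⟩
        rcases Finset.mem_insert.mp hm' with rfl | hm'
        · rw [Submonoid.coe_mul, mul_assoc, mul_assoc, hs₂]
        · rw [Submonoid.coe_mul, mul_comm (s₁ : A) (s₂ : A), mul_assoc, mul_assoc, hs₁ m' hm']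
    obtain ⟨s, hs⟩ := key ((p : A[T;T⁻¹]).coeff.support ∪ (q : A[T;T⁻¹]).coeff.support)
    refine ⟨⟨algebraMap A F.extendedRees s, Submonoid.mem_map_of_mem _ s.2⟩, Subtype.ext ?_⟩
    rw [MulMemClass.coe_mul, MulMemClass.coe_mul, Subalgebra.coe_algebraMap, ← C_eq_algebraMap]
    apply LaurentPolynomial.ext
    intro m
    rw [← single_eq_C, AddMonoidAlgebra.coeff_single_zero_mul, AddMonoidAlgebra.coeff_single_zero_mul]
    by_cases hm : m ∈ (p : A[T;T⁻¹]).coeff.support ∪ (q : A[T;T⁻¹]).coeff.support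
    · exact hs m hm
    · rw [Finset.mem_union, not_or, Finsupp.notMem_support_iff, Finsupp.notMem_support_iff] at hm
      rw [hm.1, hm.2]

include M in
/-- **Local rings of the cobordant blow-up over a point.** With `A' = M⁻¹A`, `𝒥ₙ' = 𝒥ₙ A'` and `𝔫'` a prime of
`R'[t⁻¹]`, the local ring `R'[t⁻¹]_{𝔫'}` is the localization of `R[t⁻¹]` at the contraction of `𝔫'` (localization of a
localization). For `M = A ∖ 𝔭` this reads: the local rings of `Spec(⊕ 𝒥ₙ(U) tⁿ)` at points over `𝔭` are the local rings
of the extended Rees algebra of the stalk filtration `𝒥ₙ A_𝔭`. [cite: Wlodarczyk2022, Def. 5.1.1] -/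
theorem isLocalization_atPrime_extendedRees_localization
    (heq : ∀ n, F'.ideal n = (F.ideal n).map (algebraMap A A'))
    (𝔫' : Ideal F'.extendedRees) [𝔫'.IsPrime] :
    letI := (F.extendedReesMap F' fun n => (heq n).ge).toAlgebra
    IsLocalization.AtPrime (Localization.AtPrime 𝔫')
      (𝔫'.comap (F.extendedReesMap F' fun n => (heq n).ge)) := by
  letI := (F.extendedReesMap F' fun n => (heq n).ge).toAlgebra
  haveI := F.isLocalization_extendedRees F' M heq
  exact IsLocalization.isLocalization_isLocalization_atPrime_isLocalization
    (M.map (algebraMap A F.extendedRees)) (Localization.AtPrime 𝔫') 𝔫'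

end Localization

end IdealFiltration

end Literature.AlgebraicGeometry.Resolution

end
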